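import Mathlib.Data.Real.Basic
import Mathlib.Tactic.Linarith
import Mathlib.Tactic.Ring
import Mathlib.Tactic.Positivity
import HarnessLib

/-!
# B′-forest, arithmetic core II: the root-pair cubic is concave (three-point form)

Support file for the Sahi programme (`--supports stmt-CriticalPhenomena-4575`, prover prim-sahi-p2 gen 19).  No definitions, no named
facts, no sorries; pure real arithmetic.  Memo `prim-sahi-p2/PROOF-E3.md` (29n)–(29p); companion of `…IncStarRootPairPoly`.

In the block-moment parametrisation of `IncStar.rootPairChord_poly` (near atoms `ma, Da, Ha, AL`, far atoms `mb, mc, mbc, Db, Dc, Dbc, Xb, Xc, Hb,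
Hc, Hbc, AR`; `f(q) = E₃` at the `q`-mixture of the moments under `w[e↦0]` and `w[e↦1]`), the cubic `f` satisfies the THREE-POINT identity
(`rootPairCubic_threePoint`, by `ring`)
`(p₁ − p₀)·f(p) − [(p₁ − p)·f(p₀) + (p − p₀)·f(p₁)] = (p − p₀)(p₁ − p)(p₁ − p₀)·[V₀·(3 − (p₀+p+p₁)) + V₁·(p₀+p+p₁)]/3`
with `V₁ = A_L(D_aΨ_R + D_bD_cBr_a)`, `V₀ = V₁ + 3Δ_AΔ_BΔ_C` as in (29n) (`−f″/2 = (1−t)V₀ + tV₁`).  Hence (`rootPairCubic_concave_real`) for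
`0 ≤ p₀ ≤ p ≤ p₁ ≤ 1` the interpolation inequality `(p₁ − p₀) f(p) ≥ (p₁ − p) f(p₀) + (p − p₀) f(p₁)` holds as soon as `Ψ_R ≥ 0` and `Br_a ≥ 0`:
the root-pair cubic of an apex-forest is CONCAVE on `[0,1]` — the form needed by FC's reduction cases (c-ii), (d) (PROOF-E3 (29p)), which land on
a root pair over a SUB-interval of `[0,1]`.
-/

namespace Summit.CriticalPhenomena.PercolationContinuityZ3.Theorems

namespace IncStar

/-- **Three-point identity for the root-pair cubic.** [this work] -/
theorem rootPairCubic_threePoint (p₀ p p₁ ma Da Ha AL mb mc mbc Db Dc Dbc Xb Xc Hb Hc Hbc AR : ℝ) :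
    (p₁ - p₀) * (2 * ((1 - p) * (Ha * mbc + Da * (mbc - Hbc) + (ma - Ha) * (mbc + (Xb + Xc + Dbc))) + p * ((ma + Da) * (mbc + (Xb + Xc + Dbc))))
        + ((1 - p) * (ma + Da * (1 - AR)) + p * (ma + Da)) * ((1 - p) * (mb + Db * (1 - AL)) + p * (mb + Db)) * ((1 - p) * (mc + Dc * (1 - AL)) + p * (mc + Dc))
        - (((1 - p) * (ma + Da * (1 - AR)) + p * (ma + Da)) * ((1 - p) * (AL * mbc + (1 - AL) * (mbc + (Xb + Xc + Dbc))) + p * (mbc + (Xb + Xc + Dbc)))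
          + ((1 - p) * (mb + Db * (1 - AL)) + p * (mb + Db)) * ((1 - p) * (Ha * mc + Da * (mc - Hc) + (ma - Ha) * (mc + Dc)) + p * ((ma + Da) * (mc + Dc)))
          + ((1 - p) * (mc + Dc * (1 - AL)) + p * (mc + Dc)) * ((1 - p) * (Ha * mb + Da * (mb - Hb) + (ma - Ha) * (mb + Db)) + p * ((ma + Da) * (mb + Db)))))
      - ((p₁ - p) * (2 * ((1 - p₀) * (Ha * mbc + Da * (mbc - Hbc) + (ma - Ha) * (mbc + (Xb + Xc + Dbc))) + p₀ * ((ma + Da) * (mbc + (Xb + Xc + Dbc))))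
        + ((1 - p₀) * (ma + Da * (1 - AR)) + p₀ * (ma + Da)) * ((1 - p₀) * (mb + Db * (1 - AL)) + p₀ * (mb + Db)) * ((1 - p₀) * (mc + Dc * (1 - AL)) + p₀ * (mc + Dc))
        - (((1 - p₀) * (ma + Da * (1 - AR)) + p₀ * (ma + Da)) * ((1 - p₀) * (AL * mbc + (1 - AL) * (mbc + (Xb + Xc + Dbc))) + p₀ * (mbc + (Xb + Xc + Dbc)))
          + ((1 - p₀) * (mb + Db * (1 - AL)) + p₀ * (mb + Db)) * ((1 - p₀) * (Ha * mc + Da * (mc - Hc) + (ma - Ha) * (mc + Dc)) + p₀ * ((ma + Da) * (mc + Dc)))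
          + ((1 - p₀) * (mc + Dc * (1 - AL)) + p₀ * (mc + Dc)) * ((1 - p₀) * (Ha * mb + Da * (mb - Hb) + (ma - Ha) * (mb + Db)) + p₀ * ((ma + Da) * (mb + Db)))))
        + (p - p₀) * (2 * ((1 - p₁) * (Ha * mbc + Da * (mbc - Hbc) + (ma - Ha) * (mbc + (Xb + Xc + Dbc))) + p₁ * ((ma + Da) * (mbc + (Xb + Xc + Dbc))))
        + ((1 - p₁) * (ma + Da * (1 - AR)) + p₁ * (ma + Da)) * ((1 - p₁) * (mb + Db * (1 - AL)) + p₁ * (mb + Db)) * ((1 - p₁) * (mc + Dc * (1 - AL)) + p₁ * (mc + Dc))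
        - (((1 - p₁) * (ma + Da * (1 - AR)) + p₁ * (ma + Da)) * ((1 - p₁) * (AL * mbc + (1 - AL) * (mbc + (Xb + Xc + Dbc))) + p₁ * (mbc + (Xb + Xc + Dbc)))
          + ((1 - p₁) * (mb + Db * (1 - AL)) + p₁ * (mb + Db)) * ((1 - p₁) * (Ha * mc + Da * (mc - Hc) + (ma - Ha) * (mc + Dc)) + p₁ * ((ma + Da) * (mc + Dc)))
          + ((1 - p₁) * (mc + Dc * (1 - AL)) + p₁ * (mc + Dc)) * ((1 - p₁) * (Ha * mb + Da * (mb - Hb) + (ma - Ha) * (mb + Db)) + p₁ * ((ma + Da) * (mb + Db))))))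
    = (p - p₀) * (p₁ - p) * (p₁ - p₀) * (((AL * (Da * (AR * (Xb + Xc + Dbc) - Db * Dc + Db * (Dc + Hc - AR * (mc + Dc)) + Dc * (Db + Hb - AR * (mb + Db))) + Db * Dc
        * (Da + 2 * Ha - AL * (ma + Da)))) + 3 * ((Da * AR) * (Db * AL) * (Dc * AL))) * (3 - (p₀ + p + p₁)) + (AL * (Da * (AR * (Xb + Xc + Dbc) - Db * Dc + Db * (Dc
        + Hc - AR * (mc + Dc)) + Dc * (Db + Hb - AR * (mb + Db))) + Db * Dc * (Da + 2 * Ha - AL * (ma + Da)))) * (p₀ + p + p₁)) / 3 := by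
  ring

/-- **Concavity of the root-pair cubic on `[0,1]` (three-point form)**, given `Ψ_R ≥ 0` and `Br_a ≥ 0`. [this work] -/
theorem rootPairCubic_concave_real (p₀ p p₁ ma Da Ha AL mb mc mbc Db Dc Dbc Xb Xc Hb Hc Hbc AR : ℝ)
    (h0 : 0 ≤ p₀) (h01 : p₀ ≤ p) (h12 : p ≤ p₁) (h1 : p₁ ≤ 1)
    (hAL : 0 ≤ AL) (hAR : 0 ≤ AR) (hDa : 0 ≤ Da) (hDb : 0 ≤ Db) (hDc : 0 ≤ Dc)
    (hPsi : 0 ≤ AR * (Xb + Xc + Dbc) - Db * Dc + Db * (Dc + Hc - AR * (mc + Dc)) + Dc * (Db + Hb - AR * (mb + Db)))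
    (hBr : AL * (ma + Da) ≤ Da + 2 * Ha) :
    (p₁ - p) * (2 * ((1 - p₀) * (Ha * mbc + Da * (mbc - Hbc) + (ma - Ha) * (mbc + (Xb + Xc + Dbc))) + p₀ * ((ma + Da) * (mbc + (Xb + Xc + Dbc))))
        + ((1 - p₀) * (ma + Da * (1 - AR)) + p₀ * (ma + Da)) * ((1 - p₀) * (mb + Db * (1 - AL)) + p₀ * (mb + Db)) * ((1 - p₀) * (mc + Dc * (1 - AL)) + p₀ * (mc + Dc))
        - (((1 - p₀) * (ma + Da * (1 - AR)) + p₀ * (ma + Da)) * ((1 - p₀) * (AL * mbc + (1 - AL) * (mbc + (Xb + Xc + Dbc))) + p₀ * (mbc + (Xb + Xc + Dbc)))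
          + ((1 - p₀) * (mb + Db * (1 - AL)) + p₀ * (mb + Db)) * ((1 - p₀) * (Ha * mc + Da * (mc - Hc) + (ma - Ha) * (mc + Dc)) + p₀ * ((ma + Da) * (mc + Dc)))
          + ((1 - p₀) * (mc + Dc * (1 - AL)) + p₀ * (mc + Dc)) * ((1 - p₀) * (Ha * mb + Da * (mb - Hb) + (ma - Ha) * (mb + Db)) + p₀ * ((ma + Da) * (mb + Db)))))
        + (p - p₀) * (2 * ((1 - p₁) * (Ha * mbc + Da * (mbc - Hbc) + (ma - Ha) * (mbc + (Xb + Xc + Dbc))) + p₁ * ((ma + Da) * (mbc + (Xb + Xc + Dbc))))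
        + ((1 - p₁) * (ma + Da * (1 - AR)) + p₁ * (ma + Da)) * ((1 - p₁) * (mb + Db * (1 - AL)) + p₁ * (mb + Db)) * ((1 - p₁) * (mc + Dc * (1 - AL)) + p₁ * (mc + Dc))
        - (((1 - p₁) * (ma + Da * (1 - AR)) + p₁ * (ma + Da)) * ((1 - p₁) * (AL * mbc + (1 - AL) * (mbc + (Xb + Xc + Dbc))) + p₁ * (mbc + (Xb + Xc + Dbc)))
          + ((1 - p₁) * (mb + Db * (1 - AL)) + p₁ * (mb + Db)) * ((1 - p₁) * (Ha * mc + Da * (mc - Hc) + (ma - Ha) * (mc + Dc)) + p₁ * ((ma + Da) * (mc + Dc)))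
          + ((1 - p₁) * (mc + Dc * (1 - AL)) + p₁ * (mc + Dc)) * ((1 - p₁) * (Ha * mb + Da * (mb - Hb) + (ma - Ha) * (mb + Db)) + p₁ * ((ma + Da) * (mb + Db)))))
      ≤ (p₁ - p₀) * (2 * ((1 - p) * (Ha * mbc + Da * (mbc - Hbc) + (ma - Ha) * (mbc + (Xb + Xc + Dbc))) + p * ((ma + Da) * (mbc + (Xb + Xc + Dbc))))
        + ((1 - p) * (ma + Da * (1 - AR)) + p * (ma + Da)) * ((1 - p) * (mb + Db * (1 - AL)) + p * (mb + Db)) * ((1 - p) * (mc + Dc * (1 - AL)) + p * (mc + Dc))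
        - (((1 - p) * (ma + Da * (1 - AR)) + p * (ma + Da)) * ((1 - p) * (AL * mbc + (1 - AL) * (mbc + (Xb + Xc + Dbc))) + p * (mbc + (Xb + Xc + Dbc)))
          + ((1 - p) * (mb + Db * (1 - AL)) + p * (mb + Db)) * ((1 - p) * (Ha * mc + Da * (mc - Hc) + (ma - Ha) * (mc + Dc)) + p * ((ma + Da) * (mc + Dc)))
          + ((1 - p) * (mc + Dc * (1 - AL)) + p * (mc + Dc)) * ((1 - p) * (Ha * mb + Da * (mb - Hb) + (ma - Ha) * (mb + Db)) + p * ((ma + Da) * (mb + Db))))) := by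
  have key := rootPairCubic_threePoint p₀ p p₁ ma Da Ha AL mb mc mbc Db Dc Dbc Xb Xc Hb Hc Hbc AR
  have hV1 : 0 ≤ (AL * (Da * (AR * (Xb + Xc + Dbc) - Db * Dc + Db * (Dc + Hc - AR * (mc + Dc)) + Dc * (Db + Hb - AR * (mb + Db))) + Db * Dc * (Da + 2 * Ha - AL * (ma + Da)))) :=
    mul_nonneg hAL (add_nonneg (mul_nonneg hDa hPsi) (mul_nonneg (mul_nonneg hDb hDc) (by linarith)))
  have hD3 : 0 ≤ 3 * ((Da * AR) * (Db * AL) * (Dc * AL)) :=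
    mul_nonneg (by norm_num) (mul_nonneg (mul_nonneg (mul_nonneg hDa hAR) (mul_nonneg hDb hAL)) (mul_nonneg hDc hAL))
  have hV0 : 0 ≤ ((AL * (Da * (AR * (Xb + Xc + Dbc) - Db * Dc + Db * (Dc + Hc - AR * (mc + Dc)) + Dc * (Db + Hb - AR * (mb + Db))) + Db * Dc * (Da + 2 * Ha - AL * (ma
      + Da)))) + 3 * ((Da * AR) * (Db * AL) * (Dc * AL))) := add_nonneg hV1 hD3
  have hs0 : 0 ≤ 3 - (p₀ + p + p₁) := by linarith
  have hs1 : 0 ≤ p₀ + p + p₁ := by linarith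
  have hbr : 0 ≤ ((AL * (Da * (AR * (Xb + Xc + Dbc) - Db * Dc + Db * (Dc + Hc - AR * (mc + Dc)) + Dc * (Db + Hb - AR * (mb + Db))) + Db * Dc * (Da + 2 * Ha - AL * (ma
      + Da)))) + 3 * ((Da * AR) * (Db * AL) * (Dc * AL))) * (3 - (p₀ + p + p₁)) + (AL * (Da * (AR * (Xb + Xc + Dbc) - Db * Dc + Db * (Dc + Hc - AR * (mc + Dc)) + Dc
      * (Db + Hb - AR * (mb + Db))) + Db * Dc * (Da + 2 * Ha - AL * (ma + Da)))) * (p₀ + p + p₁) :=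
    add_nonneg (mul_nonneg hV0 hs0) (mul_nonneg hV1 hs1)
  have hprod : 0 ≤ (p - p₀) * (p₁ - p) * (p₁ - p₀) :=
    mul_nonneg (mul_nonneg (by linarith) (by linarith)) (by linarith)
  have hrhs : 0 ≤ (p - p₀) * (p₁ - p) * (p₁ - p₀) * (((AL * (Da * (AR * (Xb + Xc + Dbc) - Db * Dc + Db * (Dc + Hc - AR * (mc + Dc)) + Dc * (Db + Hb - AR * (mb + Db)))
      + Db * Dc * (Da + 2 * Ha - AL * (ma + Da)))) + 3 * ((Da * AR) * (Db * AL) * (Dc * AL))) * (3 - (p₀ + p + p₁)) + (AL * (Da * (AR * (Xb + Xc + Dbc) - Db * Dc + Db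
      * (Dc + Hc - AR * (mc + Dc)) + Dc * (Db + Hb - AR * (mb + Db))) + Db * Dc * (Da + 2 * Ha - AL * (ma + Da)))) * (p₀ + p + p₁)) / 3 :=
    div_nonneg (mul_nonneg hprod hbr) (by norm_num)
  linarith [key, hrhs]

end IncStar

end Summit.CriticalPhenomena.PercolationContinuityZ3.Theorems
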